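import Summits.QuantumFields.BalabanUV.Beta.EriceRemainderEnclosureHistoryAutonomyComparisonDualOrbit

/-!
# EriceRemainderEnclosureHistoryAutonomyComparisonDualRow — (E133) **THE DUAL ROW INEQUALITY OF THE COMPARISON COLUMN — no modulus of the excess, no smallness, any
# amplitude.**  Base memory AFFINE `B u = β₀ + Σ_{k<K} L_k·u_k` (`β₀, L ≥ 0`, Markov weight `L_0` FREE; floor, modulus, unique box solutions `S p`), perturbation `B′` with the
# excess `B′ − B` ISOTONE along ordered box configurations (no modulus, size or steepness condition), ONE perturbed orbit `h′` (a box solution of `B′`) and the base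
# restarted at each of its points (the DUAL ORBIT GAUGE of (E132) `…ComparisonDualOrbit`): `X′_m := B′(tail_{m+1}h′) − B(tail_1 S h′_m)` (perturbed level step at the row
# minus the base's from the same pin).  §1 four elementary inequalities: **`sharp_deficit_le`** — base point `x` advancing by the level step `Φ`, perturbed point `w ≤ x`
# advancing by at least `(w∕x)Φ`: `(x − x₊) − (w − w₊) ≤ (x³Φ∕2)(1 − w⁴∕x⁴)` (through the intermediate base point of level `1∕x² + (w³∕x³)Φ`: one scaling and two cube
# inequalities — the lattice form of the continuum `m⁰ − m^η ≤ m⁰(1 − y⁻²)` of `HOME/b2b-balaban-beta-d4-p2/g103/README.md` §2); `deficit_le_gap` (`… ≤ x³Φ·w²δ`,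
# `δ = 1∕w² − 1∕x²`); `coupling_gap_le`; **`age_cost_le`** (`θ∕2 + (1 − x) ≤ ρ` for `ρ ≥ 1`, `0 < x ≤ 1`, `0 ≤ θ ≤ min(1, ρ²x)`: the cost of one age is within its share).
# §2 along the flows: **`dual_two_pin_le`**∕`_nonpos` (the base orbits from `(S h′_n)_1` and `h′_{n+1}` — pins at level gap `X′_n` — differ at age `k` by at most
# `X′_n·(S h′_n)_{1+k}²(S h′_{n+1})_k∕2`, with the SIGN of `X′_n`), **`dual_deficit_le`** (per age: base advance minus perturbed advance `≤ x_k³Φ⁰_k·w_k²δ_k`, by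
# `deficit_le_gap` and (E132) `affine_speed_ratio_le`), `dual_row_identity` (`X′_n − X′_{n+1}` = source difference − Σ_k L_k·[two-pin offset + base advance − perturbed
# advance]).  §3 **`dual_row_ge`**: `X′_{n+1} − max(X′_n,0)·Σ_k L_k(S h′_n)_{1+k}²(S h′_{n+1})_k∕2 − Σ_k L_k x_k³Φ⁰_k·w_k²δ_k ≤ X′_n` whenever the orbit compares from the pin
# `h′_{n+1}` and the dual steps above row `n` are non-negative.  The sequel (E134) `…ComparisonDualGauge` runs the level-gauge induction on it and proves comparison for
# EVERY isotone excess at ANY size.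

Cell `pub-balaban`, β-function sub-cell, BINDER row D4 «RemainderConst leaves for Bałaban's split» (`HOME/BINDER-OWNERS.md`; owner lineage `b2b-balaban-beta-an4`;
this file by co-owner #2 lineage `b2b-balaban-beta-d4-p2`, generation 104), β-FLOW TEAM duty (1), FREEZE (0) honoured (def-free; imports (E132) `…ComparisonDualOrbit` and
uses its `base_gap_damped` ∕ `dual_step_eq_drop` ∕ `dual_source_antitone` ∕ `affine_speed_ratio_le`, (E48a) `family_zero` ∕ `family_mem` ∕ `family_tail_eq` ∕
`le_of_pin_le`, node U2's `MemFlow` ∕ `SeqBox` ∕ `one_div_sq_one_div_sqrt` BY NAME; nothing restated).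

HONEST FRAMING (page 1, verbatim and binding).  *"Discharging BetaPertH makes Bałaban's UV stability UNCONDITIONAL — a real constructive-QFT result; it is
NOT the continuum limit and NOT the Clay problem."*  THIS FILE DISCHARGES NOTHING OF THE KIND.  Elementary real analysis about ABSTRACT functionals on a box
]0,γ]^ℕ — hypotheses of a census, not facts; the form, signs, ages and moments of Bałaban's (1.22) limit functional are NOT PRINTED ([I] p. 298; GAPS
G-t4-U2-1∕-2) and NOT asserted.  Row D4 class UNCHANGED (critical-path width 0; instance 0∕1; D4 DISCHARGE NO DATE).  HONEST DEPENDENCY: continuum YM on T⁴ ⇐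
BetaPertH ∧ nine spine estimates (0/9 proved); BetaPertH ⇐ (D1) ∧ (D4) ∧ CAP+tail.  NOT CLAIMED here: the comparison theorem (the sequel); anything printed — NOT B12
Thm 2, NOT BetaPertH, NOT continuum, NOT Clay.

WHAT IS PROVED ([folklore]; 0 `def`, 0 sorry).  §1 `coupling_gap_le`, **`sharp_deficit_le`**, `deficit_le_gap`, **`age_cost_le`**.  §2 **`dual_two_pin_le`**,
`dual_two_pin_nonpos`, **`dual_deficit_le`**, `dual_row_identity`.  §3 **`dual_row_ge`**.
-/

noncomputable section
open Finset Set

namespace Summit.QuantumFields.BalabanUV.Beta.EriceRemainderEnclosureHistoryAutonomyComparisonDualRow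

open Literature.MathematicalPhysics.QuantumFieldTheory.Balaban1983to89
open Literature.MathematicalPhysics.QuantumFieldTheory.Balaban1983to89.T4BetaStationary
open Literature.MathematicalPhysics.QuantumFieldTheory.Balaban1983to89.T4BetaFlowWellPosed

/-! ## §1 Elementary inequalities -/

/-- **THE COUPLING GAP READ WITH ONE CUBE AT THE SMALLER COUPLING**: for `0 < c′ ≤ c`, `c − c′ = (1∕c′² − 1∕c²)·c²c′²∕(c + c′) ≤ (1∕c′² − 1∕c²)·c²·c′∕2`. [folklore] -/
theorem coupling_gap_le {c c' : ℝ} (hc' : 0 < c') (hle : c' ≤ c) : c - c' ≤ (1 / c' ^ 2 - 1 / c ^ 2) * (c ^ 2 * c' / 2) := by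
  have hc : 0 < c := hc'.trans_le hle
  have e : (1 / c' ^ 2 - 1 / c ^ 2) * (c ^ 2 * c' / 2) = (c - c') * ((c + c') / (2 * c')) := by
    field_simp
    ring
  rw [e]
  have h1 : 1 ≤ (c + c') / (2 * c') := by
    rw [le_div_iff₀ (by positivity)]
    linarith
  have h0 : 0 ≤ c - c' := by linarith
  nlinarith [mul_le_mul_of_nonneg_left h1 h0]

/-- **THE SHARP DEFICIT OF ONE ROW.**  Base point `x` advancing by the level step `Φ ≥ 0` to `x₊` (`1∕x₊² = 1∕x² + Φ`), perturbed point `w ≤ x` advancing by a level step at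
least `(w∕x)·Φ` to `w₊` (`1∕w₊² ≥ 1∕w² + (w∕x)Φ`).  Then the base coupling decrement exceeds the perturbed one by at most `(x³Φ∕2)·(1 − w⁴∕x⁴)`:
`(x − x₊) − (w − w₊) ≤ (x³Φ∕2)(1 − w⁴∕x⁴)`.  Proof through the intermediate base point `c`, `1∕c² = 1∕x² + (w³∕x³)Φ`: `w − w₊ ≥ (w∕x)(x − c)` (scaling), `x − c ≤ (w³∕2)Φ`
and `c − x₊ ≤ (x³∕2)(1 − w³∕x³)Φ` (two cube inequalities) — the lattice form of the continuum's `m⁰ − m^η ≤ m⁰(1 − y⁻²)`. [folklore] -/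
theorem sharp_deficit_le {x w Φ xp wp : ℝ} (hw : 0 < w) (hwx : w ≤ x) (hΦ : 0 ≤ Φ) (hxp : 0 < xp) (hwp : 0 < wp)
    (hx_lev : 1 / xp ^ 2 = 1 / x ^ 2 + Φ) (hw_lev : 1 / w ^ 2 + w / x * Φ ≤ 1 / wp ^ 2) :
    (x - xp) - (w - wp) ≤ x ^ 3 * Φ / 2 * (1 - w ^ 4 / x ^ 4) := by
  have hx : 0 < x := hw.trans_le hwx
  -- ordered levels give ordered couplings
  have aux : ∀ {a c : ℝ}, 0 < a → 0 < c → 1 / a ^ 2 ≤ 1 / c ^ 2 → c ≤ a := fun ha hc h =>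
    (pow_le_pow_iff_left₀ hc.le ha.le two_ne_zero).mp ((one_div_le_one_div (pow_pos ha 2) (pow_pos hc 2)).mp h)
  have hr1 : w / x ≤ 1 := (div_le_one hx).mpr hwx
  have hr0 : 0 < w / x := div_pos hw hx
  -- the intermediate point c
  set Lc : ℝ := 1 / x ^ 2 + w ^ 3 / x ^ 3 * Φ with hLc
  have hLc0 : 0 < Lc := by positivity
  set c : ℝ := 1 / Real.sqrt Lc with hc
  have hc0 : 0 < c := by positivity
  have hc_lev : 1 / c ^ 2 = Lc := one_div_sq_one_div_sqrt hLc0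
  have hr3 : w ^ 3 / x ^ 3 ≤ 1 := by rw [div_le_one (by positivity)]; exact pow_le_pow_left₀ hw.le hwx 3
  -- c ≤ x and xp ≤ c
  have hcx : c ≤ x := aux hx hc0 (by rw [hc_lev, hLc]; linarith [mul_nonneg (by positivity : (0:ℝ) ≤ w ^ 3 / x ^ 3) hΦ])
  have hxpc : xp ≤ c := aux hc0 hxp (by
    rw [hc_lev, hLc, hx_lev]; nlinarith [mul_le_mul_of_nonneg_right hr3 hΦ])
  -- (i) x − c ≤ (x³/2)·(w³/x³)Φ = w³Φ/2
  have h1 : x - c ≤ w ^ 3 * Φ / 2 := by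
    have := coupling_gap_le hc0 hcx
    rw [hc_lev, hLc] at this
    have e : (1 / x ^ 2 + w ^ 3 / x ^ 3 * Φ - 1 / x ^ 2) * (x ^ 2 * c / 2) = w ^ 3 * Φ / 2 * (c / x) := by field_simp; ring
    rw [e] at this
    have hcx' : c / x ≤ 1 := (div_le_one hx).mpr hcx
    have h0 : 0 ≤ w ^ 3 * Φ / 2 := by positivity
    nlinarith [mul_le_mul_of_nonneg_left hcx' h0]
  -- (ii) c − xp ≤ (c²·xp/2)·(1 − w³/x³)Φ ≤ (x³/2)(1 − w³/x³)Φ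
  have h2 : c - xp ≤ x ^ 3 / 2 * ((1 - w ^ 3 / x ^ 3) * Φ) := by
    have := coupling_gap_le hxp hxpc
    rw [hc_lev, hLc, hx_lev] at this
    have e : (1 / x ^ 2 + Φ - (1 / x ^ 2 + w ^ 3 / x ^ 3 * Φ)) = (1 - w ^ 3 / x ^ 3) * Φ := by ring
    rw [e] at this
    have hfac : c ^ 2 * xp / 2 ≤ x ^ 3 / 2 := by
      have : c ^ 2 * xp ≤ x ^ 2 * x := mul_le_mul (pow_le_pow_left₀ hc0.le hcx 2) (hxpc.trans hcx) hxp.le (by positivity)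
      nlinarith
    have hnn : 0 ≤ (1 - w ^ 3 / x ^ 3) * Φ := mul_nonneg (by linarith) hΦ
    calc c - xp ≤ (1 - w ^ 3 / x ^ 3) * Φ * (c ^ 2 * xp / 2) := this
      _ ≤ (1 - w ^ 3 / x ^ 3) * Φ * (x ^ 3 / 2) := mul_le_mul_of_nonneg_left hfac hnn
      _ = x ^ 3 / 2 * ((1 - w ^ 3 / x ^ 3) * Φ) := by ring
  -- (iii) w − wp ≥ (w/x)(x − c): the scaled point (w/x)·c has level 1/w² + (w/x)Φ ≤ 1/wp²
  have h3 : w / x * (x - c) ≤ w - wp := by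
    have hsc0 : 0 < w / x * c := mul_pos hr0 hc0
    have hsc_lev : 1 / (w / x * c) ^ 2 = 1 / w ^ 2 + w / x * Φ := by
      rw [mul_pow, one_div, mul_inv, ← one_div, ← one_div, hc_lev, hLc]; field_simp
    have hle : wp ≤ w / x * c := aux hsc0 hwp (by rw [hsc_lev]; exact hw_lev)
    have e : w / x * (x - c) = w - w / x * c := by field_simp
    rw [e]; linarith
  -- assemble
  have e4 : x ^ 3 * Φ / 2 * (1 - w ^ 4 / x ^ 4) = (1 - w / x) * (w ^ 3 * Φ / 2) + x ^ 3 / 2 * ((1 - w ^ 3 / x ^ 3) * Φ) := by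
    field_simp; ring
  rw [e4]
  have h1' : (1 - w / x) * (x - c) ≤ (1 - w / x) * (w ^ 3 * Φ / 2) := mul_le_mul_of_nonneg_left h1 (by linarith)
  have esplit : (x - xp) - (w - wp) ≤ (1 - w / x) * (x - c) + (c - xp) := by nlinarith [h3]
  linarith [h1', h2, esplit]

/-- The sharp deficit in the form used by the row inequality: `1 − w⁴∕x⁴ ≤ 2(1 − w²∕x²) = 2w²·(1∕w² − 1∕x²)`, so
`(x − x₊) − (w − w₊) ≤ x³Φ·w²·(1∕w² − 1∕x²)` — the row's deficit is at most (cube × base step) × (perturbed coupling)² × the LEVEL GAP of the window. [folklore] -/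
theorem deficit_le_gap {x w Φ xp wp : ℝ} (hw : 0 < w) (hwx : w ≤ x) (hΦ : 0 ≤ Φ) (hxp : 0 < xp) (hwp : 0 < wp)
    (hx_lev : 1 / xp ^ 2 = 1 / x ^ 2 + Φ) (hw_lev : 1 / w ^ 2 + w / x * Φ ≤ 1 / wp ^ 2) :
    (x - xp) - (w - wp) ≤ x ^ 3 * Φ * (w ^ 2 * (1 / w ^ 2 - 1 / x ^ 2)) := by
  have hx : 0 < x := hw.trans_le hwx
  have h := sharp_deficit_le hw hwx hΦ hxp hwp hx_lev hw_lev
  have hr2 : w ^ 2 / x ^ 2 ≤ 1 := by rw [div_le_one (by positivity)]; exact pow_le_pow_left₀ hw.le hwx 2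
  have hkey : 1 - w ^ 4 / x ^ 4 ≤ 2 * (w ^ 2 * (1 / w ^ 2 - 1 / x ^ 2)) := by
    have e1 : w ^ 2 * (1 / w ^ 2 - 1 / x ^ 2) = 1 - w ^ 2 / x ^ 2 := by field_simp
    have e2 : 1 - w ^ 4 / x ^ 4 = (1 - w ^ 2 / x ^ 2) * (1 + w ^ 2 / x ^ 2) := by field_simp; ring
    rw [e1, e2]
    have h0 : 0 ≤ 1 - w ^ 2 / x ^ 2 := by linarith
    nlinarith
  have hnn : 0 ≤ x ^ 3 * Φ / 2 := by positivity
  calc (x - xp) - (w - wp) ≤ x ^ 3 * Φ / 2 * (1 - w ^ 4 / x ^ 4) := h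
    _ ≤ x ^ 3 * Φ / 2 * (2 * (w ^ 2 * (1 / w ^ 2 - 1 / x ^ 2))) := mul_le_mul_of_nonneg_left hkey hnn
    _ = x ^ 3 * Φ * (w ^ 2 * (1 / w ^ 2 - 1 / x ^ 2)) := by ring

/-- **THE COST OF ONE AGE IS WITHIN ITS SHARE.**  `ρ ≥ 1` (the base top of configuration `n` over that of configuration `n+1` at the same row), `0 < x ≤ 1` (pin level
over top level), `0 ≤ θ ≤ min(1, ρ²x)` (the first-entry ratio): `θ∕2 + (1 − x) ≤ ρ`.  (If `ρ²x ≥ 1` then `ρ ≥ 3∕2 − x` since `(3∕2 − x)²x ≤ 1∕2`; if `ρ²x ≤ 1` and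
`ρ ≥ 3∕2` use `θ ≤ 1`; if `ρ ≤ 3∕2` then `ρ²x∕2 ≤ (3∕4)ρx` and `(ρ − 1)(1 − 3x∕4) + x∕4 ≥ 0`.) [folklore] -/
theorem age_cost_le {ρ x θ : ℝ} (hρ : 1 ≤ ρ) (hx0 : 0 < x) (hx1 : x ≤ 1) (hθ0 : 0 ≤ θ) (hθ1 : θ ≤ 1) (hθρ : θ ≤ ρ ^ 2 * x) :
    θ / 2 + (1 - x) ≤ ρ := by
  by_cases hA : 3 / 2 ≤ ρ
  · linarith
  · have hA' : ρ < 3 / 2 := lt_of_not_ge hA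
    -- θ ≤ ρ²x ≤ (3/2)ρx
    have h1 : ρ ^ 2 * x ≤ 3 / 2 * ρ * x := by nlinarith
    nlinarith

/-! ## §2 Along the flows: the two-pin offset, the deficit of one age, the row identity -/

open Summit.QuantumFields.BalabanUV.Beta.EriceRemainderEnclosureHistoryAutonomyOrder
  (family_zero family_mem family_tail_eq family_succ_eq le_of_pin_le strictAnti_of_memFlow)
open Summit.QuantumFields.BalabanUV.Beta.EriceRemainderEnclosureHistoryAutonomyComparisonDualOrbit
  (base_gap_damped dual_step_eq_drop dual_source_antitone affine_speed_ratio_le dual_gap_le_sum_steps cmp_of_dual_steps_nonneg)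

variable {B B' : (ℕ → ℝ) → ℝ} {M γ b β₀ : ℝ} {L : ℕ → ℝ} {K : ℕ} {S : ℝ → ℕ → ℝ} {h' : ℕ → ℝ}

/-- **THE TWO-PIN OFFSET (sign of the dual step).**  Base `B` isotone with floor, modulus, unique box solutions `S p`; `h′` a box sequence.  The base orbits from the two
points one row above `h′_n` — the base's own `(S h′_n)_1` and the perturbed `h′_{n+1}` — are ordered by their pins; when `h′_{n+1} ≤ (S h′_n)_1` (dual step `X′_n ≥ 0`)
their age-`k` couplings satisfy `0 ≤ (S h′_n)_{1+k} − (S h′_{n+1})_k ≤ X′_n·(S h′_n)_{1+k}²·(S h′_{n+1})_k∕2`, `X′_n = 1∕h′_{n+1}² − 1∕(S h′_n)_1²` (level gap ≤ pin gap by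
`base_gap_damped`, then `coupling_gap_le`). [folklore] -/
theorem dual_two_pin_le (hb : 0 < b)
    (hmono : ∀ u v : ℕ → ℝ, SeqBox γ u → SeqBox γ v → (∀ i, u i ≤ v i) → B u ≤ B v)
    (hB : ∀ u u' : ℕ → ℝ, SeqBox γ u → SeqBox γ u' → ∀ D : ℝ, (∀ j, |u j - u' j| ≤ D) → |B u - B u'| ≤ M * D) (hM : 0 ≤ M)
    (hlo : ∀ u, SeqBox γ u → b ≤ B u)
    (hS : ∀ p, 0 < p → p ≤ γ → SeqBox γ (S p) ∧ MemFlow B p (S p))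
    (huniq : ∀ p, 0 < p → p ≤ γ → ∀ u u' : ℕ → ℝ, SeqBox γ u → SeqBox γ u' → MemFlow B p u → MemFlow B p u' → u = u')
    (hh' : SeqBox γ h') (n : ℕ) (hle : h' (n + 1) ≤ S (h' n) 1) (k : ℕ) :
    0 ≤ S (h' n) (1 + k) - S (h' (n + 1)) k
      ∧ S (h' n) (1 + k) - S (h' (n + 1)) k ≤ (1 / h' (n + 1) ^ 2 - 1 / S (h' n) 1 ^ 2) * (S (h' n) (1 + k) ^ 2 * S (h' (n + 1)) k / 2) := by
  have hpn := hh' n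
  have hpn1 := hh' (n + 1)
  have hz := family_mem hS hpn.1 hpn.2 1
  have htail : (fun j => S (h' n) (1 + j)) = S (S (h' n) 1) := family_tail_eq hS huniq hpn.1 hpn.2 1
  have hk := hS (S (h' n) 1) hz.1 hz.2
  have hk' := hS (h' (n + 1)) hpn1.1 hpn1.2
  have hleS : ∀ j, S (h' (n + 1)) j ≤ S (S (h' n) 1) j := fun j =>
    le_of_pin_le hb hB hM hlo huniq hpn1.1 hle hz.2 hk'.1 hk.1 hk'.2 hk.2 j
  have etail : ∀ j, S (h' n) (1 + j) = S (S (h' n) 1) j := fun j => congrFun htail j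
  have hc' : 0 < S (h' (n + 1)) k := (hk'.1 k).1
  have hcc : S (h' (n + 1)) k ≤ S (h' n) (1 + k) := by rw [etail k]; exact hleS k
  refine ⟨by linarith, ?_⟩
  have hgap := base_gap_damped hmono hk.1 hk.2 hk'.1 hk'.2 hleS k
  rw [← etail k] at hgap
  have hcg := coupling_gap_le hc' hcc
  have hnn : 0 ≤ S (h' n) (1 + k) ^ 2 * S (h' (n + 1)) k / 2 := by have := (hk.1 k).1; positivity
  exact hcg.trans (mul_le_mul_of_nonneg_right hgap hnn)

/-- … and when `(S h′_n)_1 ≤ h′_{n+1}` (dual step `X′_n ≤ 0`) the offset has the other sign: `(S h′_n)_{1+k} ≤ (S h′_{n+1})_k`. [folklore] -/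
theorem dual_two_pin_nonpos (hb : 0 < b)
    (hB : ∀ u u' : ℕ → ℝ, SeqBox γ u → SeqBox γ u' → ∀ D : ℝ, (∀ j, |u j - u' j| ≤ D) → |B u - B u'| ≤ M * D) (hM : 0 ≤ M)
    (hlo : ∀ u, SeqBox γ u → b ≤ B u)
    (hS : ∀ p, 0 < p → p ≤ γ → SeqBox γ (S p) ∧ MemFlow B p (S p))
    (huniq : ∀ p, 0 < p → p ≤ γ → ∀ u u' : ℕ → ℝ, SeqBox γ u → SeqBox γ u' → MemFlow B p u → MemFlow B p u' → u = u')
    (hh' : SeqBox γ h') (n : ℕ) (hle : S (h' n) 1 ≤ h' (n + 1)) (k : ℕ) :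
    S (h' n) (1 + k) - S (h' (n + 1)) k ≤ 0 := by
  have hpn := hh' n
  have hpn1 := hh' (n + 1)
  have hz := family_mem hS hpn.1 hpn.2 1
  have htail : (fun j => S (h' n) (1 + j)) = S (S (h' n) 1) := family_tail_eq hS huniq hpn.1 hpn.2 1
  have hk := hS (S (h' n) 1) hz.1 hz.2
  have hk' := hS (h' (n + 1)) hpn1.1 hpn1.2
  have := le_of_pin_le hb hB hM hlo huniq hz.1 hle hpn1.2 hk.1 hk'.1 hk.2 hk'.2 k
  rw [congrFun htail k]; linarith

/-- **THE DEFICIT OF ONE AGE.**  Affine base `B u = β₀ + Σ L_k u_k` (`β₀, L ≥ 0`; isotone, floor, modulus, unique solutions); `h′` a box solution of ANY `B′`; pin `h′_j`,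
age `k`, base top `x = (S h′_j)_k` with step `Φ⁰ = 1∕(S h′_j)_{k+1}² − 1∕x²`, perturbed top `w = h′_{j+k} ≤ x` (comparison) whose own dual step is non-negative
(`B(tail_1 S w) ≤ B′(tail_{j+k+1}h′)`).  Then the base top advances by at most `x³Φ⁰·w²·(1∕w² − 1∕x²)` more than the perturbed top:
`((S h′_j)_k − (S h′_j)_{k+1}) − (h′_{j+k} − h′_{j+k+1}) ≤ x³Φ⁰·w²δ`, `δ = 1∕w² − 1∕x²` the window gap — `deficit_le_gap` with the perturbed step `≥ (w∕x)Φ⁰` by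
`affine_speed_ratio_le` («Φ₀√ℓ isotone»). [folklore] -/
theorem dual_deficit_le (hBaff : ∀ u, SeqBox γ u → B u = β₀ + ∑ k ∈ range K, L k * u k) (hβ₀ : 0 ≤ β₀) (hL : ∀ k, 0 ≤ L k)
    (hb : 0 < b)
    (hmono : ∀ u v : ℕ → ℝ, SeqBox γ u → SeqBox γ v → (∀ i, u i ≤ v i) → B u ≤ B v)
    (hB : ∀ u u' : ℕ → ℝ, SeqBox γ u → SeqBox γ u' → ∀ D : ℝ, (∀ j, |u j - u' j| ≤ D) → |B u - B u'| ≤ M * D) (hM : 0 ≤ M)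
    (hlo : ∀ u, SeqBox γ u → b ≤ B u)
    (hS : ∀ p, 0 < p → p ≤ γ → SeqBox γ (S p) ∧ MemFlow B p (S p))
    (huniq : ∀ p, 0 < p → p ≤ γ → ∀ u u' : ℕ → ℝ, SeqBox γ u → SeqBox γ u' → MemFlow B p u → MemFlow B p u' → u = u')
    (hh' : SeqBox γ h') {y : ℝ} (hf' : MemFlow B' y h') (j k : ℕ) (hcmp : h' (j + k) ≤ S (h' j) k)
    (hX : B (fun i => S (h' (j + k)) (1 + i)) ≤ B' (fun i => h' (j + k + 1 + i))) :
    (S (h' j) k - S (h' j) (k + 1)) - (h' (j + k) - h' (j + k + 1))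
      ≤ S (h' j) k ^ 3 * (1 / S (h' j) (k + 1) ^ 2 - 1 / S (h' j) k ^ 2) * (h' (j + k) ^ 2 * (1 / h' (j + k) ^ 2 - 1 / S (h' j) k ^ 2)) := by
  have hpj := hh' j
  have hSj := hS (h' j) hpj.1 hpj.2
  have hx := family_mem hS hpj.1 hpj.2 k
  have hw0 : 0 < h' (j + k) := (hh' (j + k)).1
  have hxp : 0 < S (h' j) (k + 1) := (hSj.1 (k + 1)).1
  have hwp : 0 < h' (j + k + 1) := (hh' (j + k + 1)).1
  -- the base step at the top: Φ⁰ = B(tail_{k+1} S h′_j) = B(tail_1 S x)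
  have hx_lev : 1 / S (h' j) (k + 1) ^ 2 = 1 / S (h' j) k ^ 2 + B (fun i => S (h' j) (k + 1 + i)) := hSj.2.2 k
  have htail : (fun i => S (h' j) (k + 1 + i)) = (fun i => S (S (h' j) k) (1 + i)) := by
    funext i
    have := congrFun (family_tail_eq hS huniq hpj.1 hpj.2 k) (1 + i)
    simpa [Nat.add_assoc] using this
  have hΦ0 : 0 ≤ B (fun i => S (h' j) (k + 1 + i)) := hb.le.trans (hlo _ (fun i => hSj.1 (k + 1 + i)))
  -- the perturbed step at the top is at least (w/x)·Φ⁰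
  have hw_lev : 1 / h' (j + k) ^ 2 + h' (j + k) / S (h' j) k * B (fun i => S (h' j) (k + 1 + i)) ≤ 1 / h' (j + k + 1) ^ 2 := by
    have hstep : 1 / h' (j + k + 1) ^ 2 = 1 / h' (j + k) ^ 2 + B' (fun i => h' (j + k + 1 + i)) := hf'.2 (j + k)
    have hratio := affine_speed_ratio_le hBaff hβ₀ hL hb hmono hB hM hlo hS huniq hw0 hcmp hx.2
    -- hratio : h′(j+k) · B(tail_1 S x) ≤ x · B(tail_1 S w)
    rw [htail, hstep]
    have hxpos : 0 < S (h' j) k := hx.1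
    have h1 : h' (j + k) / S (h' j) k * B (fun i => S (S (h' j) k) (1 + i)) ≤ B (fun i => S (h' (j + k)) (1 + i)) := by
      rw [div_mul_eq_mul_div, div_le_iff₀ hxpos]
      linarith [hratio]
    linarith [h1, hX]
  have h := deficit_le_gap hw0 hcmp hΦ0 hxp hwp hx_lev hw_lev
  have e : B (fun i => S (h' j) (k + 1 + i)) = 1 / S (h' j) (k + 1) ^ 2 - 1 / S (h' j) k ^ 2 := by rw [hx_lev]; ring
  rw [e] at h
  exact h

/-- **THE DUAL ROW IDENTITY.**  For the affine base and ANY `B′` with box solution `h′`: with `X′_m = B′(tail_{m+1}h′) − B(tail_1 S h′_m)`, `E_m = (B′ − B)(tail_{m+1}h′)`,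
`X′_n − X′_{n+1} = (E_n − E_{n+1}) − Σ_k L_k·[((S h′_n)_{1+k} − (S h′_{n+1})_k) + ((S h′_{n+1})_k − (S h′_{n+1})_{k+1}) − (h′_{n+1+k} − h′_{n+1+k+1})]`
— TWO-PIN OFFSET + BASE ADVANCE − PERTURBED ADVANCE, age by age (`dual_step_eq_drop` twice). [folklore] -/
theorem dual_row_identity (hBaff : ∀ u, SeqBox γ u → B u = β₀ + ∑ k ∈ range K, L k * u k)
    (hS : ∀ p, 0 < p → p ≤ γ → SeqBox γ (S p) ∧ MemFlow B p (S p)) (hh' : SeqBox γ h') (n : ℕ) :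
    (B' (fun i => h' (n + 1 + i)) - B (fun i => S (h' n) (1 + i))) - (B' (fun i => h' (n + 1 + 1 + i)) - B (fun i => S (h' (n + 1)) (1 + i)))
      = ((B' (fun i => h' (n + 1 + i)) - B (fun i => h' (n + 1 + i))) - (B' (fun i => h' (n + 1 + 1 + i)) - B (fun i => h' (n + 1 + 1 + i))))
        - ∑ k ∈ range K, L k * ((S (h' n) (1 + k) - S (h' (n + 1)) k) + (S (h' (n + 1)) k - S (h' (n + 1)) (k + 1))
            - (h' (n + 1 + k) - h' (n + 1 + k + 1))) := by
  rw [dual_step_eq_drop (B' := B') hBaff hS hh' n, dual_step_eq_drop (B' := B') hBaff hS hh' (n + 1)]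
  have e : ∀ k, L k * ((S (h' n) (1 + k) - S (h' (n + 1)) k) + (S (h' (n + 1)) k - S (h' (n + 1)) (k + 1)) - (h' (n + 1 + k) - h' (n + 1 + k + 1)))
      = L k * (S (h' n) (1 + k) - h' (n + 1 + k)) - L k * (S (h' (n + 1)) (1 + k) - h' (n + 1 + 1 + k)) := by
    intro k
    rw [show n + 1 + k + 1 = n + 1 + 1 + k by ring, show k + 1 = 1 + k by ring]
    ring
  rw [sum_congr rfl fun k _ => e k, sum_sub_distrib]
  ring

/-! ## §3 The dual row inequality -/

/-- **THE DUAL ROW INEQUALITY.**  Affine base `B u = β₀ + Σ_{k<K} L_k u_k` (`β₀, L ≥ 0`; floor `b > 0`, modulus, unique box solutions `S p`), `B′` with the excess `B′ − B`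
ISOTONE along ordered box configurations (no modulus, size or steepness condition), `h′` a non-increasing box solution of `B′`.  At a row `n` where the perturbed orbit
compares with the base restarted one row up (`h′_{n+1+l} ≤ (S h′_{n+1})_l`) and the dual steps above are non-negative (`X′_{n+1+l} ≥ 0`):
`X′_{n+1} − max(X′_n, 0)·Σ_k L_k (S h′_n)_{1+k}²(S h′_{n+1})_k∕2 − Σ_k L_k x_k³Φ⁰_k·w_k²δ_k ≤ X′_n`
(`x_k = (S h′_{n+1})_k`, `Φ⁰_k` its base step, `w_k = h′_{n+1+k}`, `δ_k = 1∕w_k² − 1∕x_k²` the dual window gap) — source dropped by `dual_source_antitone`, two-pin offset by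
`dual_two_pin_le`∕`_nonpos`, per-age deficit by `dual_deficit_le`.  NO modulus of the excess, NO smallness. [folklore] -/
theorem dual_row_ge (hBaff : ∀ u, SeqBox γ u → B u = β₀ + ∑ k ∈ range K, L k * u k) (hβ₀ : 0 ≤ β₀) (hL : ∀ k, 0 ≤ L k)
    (hb : 0 < b)
    (hmono : ∀ u v : ℕ → ℝ, SeqBox γ u → SeqBox γ v → (∀ i, u i ≤ v i) → B u ≤ B v)
    (hB : ∀ u u' : ℕ → ℝ, SeqBox γ u → SeqBox γ u' → ∀ D : ℝ, (∀ j, |u j - u' j| ≤ D) → |B u - B u'| ≤ M * D) (hM : 0 ≤ M)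
    (hlo : ∀ u, SeqBox γ u → b ≤ B u)
    (hS : ∀ p, 0 < p → p ≤ γ → SeqBox γ (S p) ∧ MemFlow B p (S p))
    (huniq : ∀ p, 0 < p → p ≤ γ → ∀ u u' : ℕ → ℝ, SeqBox γ u → SeqBox γ u' → MemFlow B p u → MemFlow B p u' → u = u')
    (hDmono : ∀ u v : ℕ → ℝ, SeqBox γ u → SeqBox γ v → (∀ i, u i ≤ v i) → B' u - B u ≤ B' v - B v)
    (hh' : SeqBox γ h') (hanti : Antitone h') {y : ℝ} (hf' : MemFlow B' y h') (n : ℕ)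
    (hcmp : ∀ l, h' (n + 1 + l) ≤ S (h' (n + 1)) l)
    (hXup : ∀ l, 0 ≤ B' (fun i => h' (n + 1 + l + 1 + i)) - B (fun i => S (h' (n + 1 + l)) (1 + i))) :
    (B' (fun i => h' (n + 1 + 1 + i)) - B (fun i => S (h' (n + 1)) (1 + i)))
      - max (B' (fun i => h' (n + 1 + i)) - B (fun i => S (h' n) (1 + i))) 0 * ∑ k ∈ range K, L k * (S (h' n) (1 + k) ^ 2 * S (h' (n + 1)) k / 2)
      - ∑ k ∈ range K, L k * (S (h' (n + 1)) k ^ 3 * (1 / S (h' (n + 1)) (k + 1) ^ 2 - 1 / S (h' (n + 1)) k ^ 2)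
          * (h' (n + 1 + k) ^ 2 * (1 / h' (n + 1 + k) ^ 2 - 1 / S (h' (n + 1)) k ^ 2)))
      ≤ B' (fun i => h' (n + 1 + i)) - B (fun i => S (h' n) (1 + i)) := by
  have hid := dual_row_identity (B' := B') hBaff hS hh' n
  -- the source only grows going down
  have hsrc := dual_source_antitone (B := B) (B' := B') hDmono hh' hanti n
  rw [show n + 2 = n + 1 + 1 by ring] at hsrc
  -- the level form of X′_n
  have hpn := hh' n
  have hSn := hS (h' n) hpn.1 hpn.2
  have hXlev : B' (fun i => h' (n + 1 + i)) - B (fun i => S (h' n) (1 + i)) = 1 / h' (n + 1) ^ 2 - 1 / S (h' n) 1 ^ 2 := by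
    have e1 : 1 / h' (n + 1) ^ 2 = 1 / h' n ^ 2 + B' (fun i => h' (n + 1 + i)) := hf'.2 n
    have e2 : 1 / S (h' n) (0 + 1) ^ 2 = 1 / S (h' n) 0 ^ 2 + B (fun i => S (h' n) (0 + 1 + i)) := hSn.2.2 0
    rw [family_zero hS hpn.1 hpn.2] at e2
    simp only [Nat.zero_add] at e2
    have e3 : (fun i => S (h' n) (0 + 1 + i)) = (fun i => S (h' n) (1 + i)) := by funext i; simp
    rw [e3] at e2
    linarith
  set X0 : ℝ := B' (fun i => h' (n + 1 + i)) - B (fun i => S (h' n) (1 + i)) with hX0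
  -- per age: two-pin offset
  have hT1 : ∀ k ∈ range K, L k * (S (h' n) (1 + k) - S (h' (n + 1)) k) ≤ max X0 0 * (L k * (S (h' n) (1 + k) ^ 2 * S (h' (n + 1)) k / 2)) := by
    intro k _
    have hpos : 0 ≤ L k * (S (h' n) (1 + k) ^ 2 * S (h' (n + 1)) k / 2) := by
      have := hL k; have := (hSn.1 (1 + k)).1; have := ((hS _ (hh' (n + 1)).1 (hh' (n + 1)).2).1 k).1; positivity
    rcases le_total (h' (n + 1)) (S (h' n) 1) with hle | hle
    · obtain ⟨_, h2⟩ := dual_two_pin_le hb hmono hB hM hlo hS huniq hh' n hle k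
      rw [← hXlev] at h2
      have h3 := mul_le_mul_of_nonneg_left h2 (hL k)
      have h4 : X0 ≤ max X0 0 := le_max_left _ _
      have h5 : 0 ≤ S (h' n) (1 + k) ^ 2 * S (h' (n + 1)) k / 2 := by
        have := (hSn.1 (1 + k)).1; have := ((hS _ (hh' (n + 1)).1 (hh' (n + 1)).2).1 k).1; positivity
      calc L k * (S (h' n) (1 + k) - S (h' (n + 1)) k) ≤ L k * (X0 * (S (h' n) (1 + k) ^ 2 * S (h' (n + 1)) k / 2)) := h3
        _ ≤ L k * (max X0 0 * (S (h' n) (1 + k) ^ 2 * S (h' (n + 1)) k / 2)) :=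
          mul_le_mul_of_nonneg_left (mul_le_mul_of_nonneg_right h4 h5) (hL k)
        _ = max X0 0 * (L k * (S (h' n) (1 + k) ^ 2 * S (h' (n + 1)) k / 2)) := by ring
    · have h2 := dual_two_pin_nonpos hb hB hM hlo hS huniq hh' n hle k
      have h3 : L k * (S (h' n) (1 + k) - S (h' (n + 1)) k) ≤ 0 := mul_nonpos_of_nonneg_of_nonpos (hL k) h2
      have h4 : 0 ≤ max X0 0 * (L k * (S (h' n) (1 + k) ^ 2 * S (h' (n + 1)) k / 2)) := mul_nonneg (le_max_right _ _) hpos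
      linarith
  -- per age: deficit
  have hD : ∀ k ∈ range K, L k * ((S (h' (n + 1)) k - S (h' (n + 1)) (k + 1)) - (h' (n + 1 + k) - h' (n + 1 + k + 1)))
      ≤ L k * (S (h' (n + 1)) k ^ 3 * (1 / S (h' (n + 1)) (k + 1) ^ 2 - 1 / S (h' (n + 1)) k ^ 2)
          * (h' (n + 1 + k) ^ 2 * (1 / h' (n + 1 + k) ^ 2 - 1 / S (h' (n + 1)) k ^ 2))) := by
    intro k _
    refine mul_le_mul_of_nonneg_left ?_ (hL k)
    exact dual_deficit_le (B' := B') hBaff hβ₀ hL hb hmono hB hM hlo hS huniq hh' hf' (n + 1) k (hcmp k) (by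
      have := hXup k; linarith)
  have hsumT := sum_le_sum hT1
  have hsumD := sum_le_sum hD
  rw [← mul_sum] at hsumT
  -- split the identity's sum
  have hsplit : ∑ k ∈ range K, L k * ((S (h' n) (1 + k) - S (h' (n + 1)) k) + (S (h' (n + 1)) k - S (h' (n + 1)) (k + 1))
      - (h' (n + 1 + k) - h' (n + 1 + k + 1)))
      = ∑ k ∈ range K, L k * (S (h' n) (1 + k) - S (h' (n + 1)) k)
        + ∑ k ∈ range K, L k * ((S (h' (n + 1)) k - S (h' (n + 1)) (k + 1)) - (h' (n + 1 + k) - h' (n + 1 + k + 1))) := by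
    rw [← sum_add_distrib]; exact sum_congr rfl fun k _ => by ring
  rw [hsplit] at hid
  linarith [hid, hsrc, hsumT, hsumD]

end Summit.QuantumFields.BalabanUV.Beta.EriceRemainderEnclosureHistoryAutonomyComparisonDualRow

end
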